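import Mathlib
import Summits.Ventures.PercRepro2.StarOBStar
import Summits.Ventures.PercRepro2.StarOEvAlgMain

/-!
# The two-coin star `{o, b}` at `a₃`: the outcome transfer and the `Q`/`PD` masses
(blind cell PercRepro2, night-1 g10; NIGHT1-G10.md §1)

Every mass of `HMFc` is an event `E₀` of `G` (possibly intersected with a star-closed event);
on each coin outcome it is a star-closed event `E'` (`set_eq_of_pointwise`), so
`P(E₀ ∩ viaStar X) = Σ_{b₁ b₂} cw b₁ r · cw b₂ s · P₀(E' b₁ b₂ ∩ X)` (`prob_star_of_pointwise`).
The per-outcome reading of each event is a pointwise lemma (`Q_pt`, `PD_pt`, …).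
-/

namespace Summit.Ventures.PercRepro2

open StarGlue PendantRoot

namespace StarOB

section Transfer

variable {V : Type*} {E : Type*} [Fintype E] [DecidableEq E] [Fintype V] [DecidableEq V]
  {R : Type*} [Field R] [LinearOrder R] [IsStrictOrderedRing R]

variable (p : E → R) (ends : E → Sym2 V) {f₁ f₂ : E} {a₃ o b a₁ a₂ : V}

open StarO (pOut viaStar cw prob_viaStar free_viaStar)

omit [Fintype E] [DecidableEq E] [LinearOrder R] [IsStrictOrderedRing R] in
/-- `a₃ ↔ y` iff `y` is reached from `o` through the open `o`-coin or from `b` through the open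
`b`-coin (read in `ω` itself). -/
lemma conn_a3_iff (hf₁ : ends f₁ = s(a₃, o)) (hf₂ : ends f₂ = s(a₃, b))
    (hstar : ∀ e, a₃ ∈ ends e → e = f₁ ∨ e = f₂) (h3o : a₃ ≠ o) (h3b : a₃ ≠ b) {ω : Config E}
    {y : V} (hy : y ≠ a₃) :
    Conn ends ω a₃ y ↔ (ω f₁ = true ∧ Conn ends ω o y) ∨ (ω f₂ = true ∧ Conn ends ω b y) := by
  constructor
  · intro h
    rw [conn_a3_iff_glue hy] at h
    obtain ⟨m, hm, hmy⟩ := h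
    rw [openAdj_a3_iff hf₁ hf₂ hstar h3o h3b] at hm
    rcases hm with ⟨h1, rfl⟩ | ⟨h2, rfl⟩
    · exact Or.inl ⟨h1, conn_mono (restrict_le _ ω) hmy⟩
    · exact Or.inr ⟨h2, conn_mono (restrict_le _ ω) hmy⟩
  · rintro (⟨h1, h⟩ | ⟨h2, h⟩)
    · exact conn_trans (conn_a3_o_of_f1 hf₁ h1) h
    · exact conn_trans (conn_a3_b_of_f2 hf₂ h2) h

omit [Fintype E] [DecidableEq E] [LinearOrder R] [IsStrictOrderedRing R] in
/-- A pointwise reading on an outcome gives the set identity with any star-closed event. -/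
lemma set_eq_of_pointwise {E₀ E' : Set (Config E)} {b₁ b₂ : Bool}
    (h : ∀ ω ∈ outc₂ f₁ f₂ b₁ b₂, ω ∈ E₀ ↔ closeStar ends a₃ ω ∈ E') (X : Set (Config E)) :
    E₀ ∩ viaStar ends a₃ X ∩ outc₂ f₁ f₂ b₁ b₂ =
      viaStar ends a₃ (E' ∩ X) ∩ outc₂ f₁ f₂ b₁ b₂ := by
  ext ω
  simp only [Set.mem_inter_iff, viaStar, Set.mem_setOf_eq]
  constructor
  · rintro ⟨⟨hE, hX⟩, hO⟩; exact ⟨⟨(h ω hO).1 hE, hX⟩, hO⟩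
  · rintro ⟨⟨hE, hX⟩, hO⟩; exact ⟨⟨(h ω hO).2 hE, hX⟩, hO⟩

/-- The four star-closed readings of an event, indexed by the outcome. -/
def tbl (A B C D : Set (Config E)) : Bool → Bool → Set (Config E) := fun b₁ b₂ =>
  if b₁ then (if b₂ then D else B) else (if b₂ then C else A)

omit [LinearOrder R] [IsStrictOrderedRing R] in
/-- **The factorised form of a mass** from its pointwise readings. -/
theorem prob_star_of_pointwise (hf₁ : ends f₁ = s(a₃, o)) (hf₂ : ends f₂ = s(a₃, b))
    (h12 : f₁ ≠ f₂) (E₀ : Set (Config E)) (E' : Bool → Bool → Set (Config E))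
    (h : ∀ b₁ b₂, ∀ ω ∈ outc₂ f₁ f₂ b₁ b₂, ω ∈ E₀ ↔ closeStar ends a₃ ω ∈ E' b₁ b₂)
    (X : Set (Config E)) :
    prob p (E₀ ∩ viaStar ends a₃ X) =
      ∑ b₁ : Bool, ∑ b₂ : Bool,
        prob (pOut p ends a₃) (E' b₁ b₂ ∩ X) * cw b₁ (p f₁) * cw b₂ (p f₂) := by
  have hf1 : a₃ ∈ ends f₁ := by rw [hf₁]; exact Sym2.mem_mk_left _ _
  have hf2 : a₃ ∈ ends f₂ := by rw [hf₂]; exact Sym2.mem_mk_left _ _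
  rw [prob_eq_sum_outc₂ p f₁ f₂]
  refine Finset.sum_congr rfl fun b₁ _ => Finset.sum_congr rfl fun b₂ _ => ?_
  rw [set_eq_of_pointwise ends (h b₁ b₂) X,
    prob_inter_outc₂ p h12 (free_viaStar ends a₃ hf1 _) (free_viaStar ends a₃ hf2 _), prob_viaStar]

omit [LinearOrder R] [IsStrictOrderedRing R] in
/-- The factorised form, written out over the four outcomes (`A`: both closed, `B`: `o`-coin open,
`C`: `b`-coin open, `D`: both open). -/
theorem prob_star_tbl (hf₁ : ends f₁ = s(a₃, o)) (hf₂ : ends f₂ = s(a₃, b)) (h12 : f₁ ≠ f₂)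
    (E₀ A B C D : Set (Config E))
    (h : ∀ b₁ b₂, ∀ ω ∈ outc₂ f₁ f₂ b₁ b₂, ω ∈ E₀ ↔ closeStar ends a₃ ω ∈ tbl A B C D b₁ b₂)
    (X : Set (Config E)) :
    prob p (E₀ ∩ viaStar ends a₃ X) =
      (1 - p f₁) * (1 - p f₂) * prob (pOut p ends a₃) (A ∩ X) +
        p f₁ * (1 - p f₂) * prob (pOut p ends a₃) (B ∩ X) +
        (1 - p f₁) * p f₂ * prob (pOut p ends a₃) (C ∩ X) +
        p f₁ * p f₂ * prob (pOut p ends a₃) (D ∩ X) := by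
  rw [prob_star_of_pointwise p ends hf₁ hf₂ h12 E₀ _ h X]
  simp only [Fintype.sum_bool, tbl, cw, ↓reduceIte, Bool.false_eq_true]
  ring

end Transfer

section Pointwise

variable {V : Type*} {E : Type*} [Fintype E] [Fintype V] [DecidableEq V]

variable (ends : E → Sym2 V) {f₁ f₂ : E} {a₃ o b a₁ a₂ : V}

/-- The glued `Q`: `Q₁` minus the two configurations in which the glue joins the roots. -/
def Qg (ends : E → Sym2 V) (o a₁ a₂ b : V) : Set (Config E) :=
  avoidAll ends a₂ {a₁} ∩ (connEvent ends a₁ o ∩ connEvent ends b a₂)ᶜ ∩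
    (connEvent ends a₁ b ∩ connEvent ends o a₂)ᶜ

/-- `o ∉ U` in the star-closed configuration. -/
def oN (ends : E → Sym2 V) (o a₁ a₂ : V) : Set (Config E) :=
  (connEvent ends o a₁)ᶜ ∩ (connEvent ends o a₂)ᶜ

/-- The reading of `Q` on the four outcomes. -/
theorem Q_pt (hf₁ : ends f₁ = s(a₃, o)) (hf₂ : ends f₂ = s(a₃, b))
    (hstar : ∀ e, a₃ ∈ ends e → e = f₁ ∨ e = f₂) (h3o : a₃ ≠ o) (h3b : a₃ ≠ b) (h31 : a₃ ≠ a₁)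
    (h32 : a₃ ≠ a₂) (b₁ b₂ : Bool) :
    ∀ ω ∈ outc₂ f₁ f₂ b₁ b₂, ω ∈ avoidAll ends a₂ {a₁} ↔
      closeStar ends a₃ ω ∈ tbl (avoidAll ends a₂ {a₁}) (avoidAll ends a₂ {a₁})
        (avoidAll ends a₂ {a₁}) (Qg ends o a₁ a₂ b) b₁ b₂ := by
  rintro ω ⟨h1, h2⟩
  cases b₁ <;> cases b₂ <;>
    simp only [tbl, Qg, ↓reduceIte, Bool.false_eq_true, avoidAll_eq_compl, Set.mem_inter_iff,
      Set.mem_compl_iff, mem_connEvent]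
  · rw [conn_iff_single hf₁ hf₂ hstar h3o h3b (by simp [h1]) h31.symm h32.symm]
  · rw [conn_iff_single hf₁ hf₂ hstar h3o h3b (by simp [h1]) h31.symm h32.symm]
  · rw [conn_iff_single hf₁ hf₂ hstar h3o h3b (by simp [h2]) h31.symm h32.symm]
  · rw [conn_iff_glue_ob hf₁ hf₂ hstar h3o h3b h1 h2 h31.symm h32.symm]
    tauto

/-- The reading of `PD` on the four outcomes: `a₃ ∈ U` iff an open coin leads into `U`. -/
theorem PD_pt (hf₁ : ends f₁ = s(a₃, o)) (hf₂ : ends f₂ = s(a₃, b))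
    (hstar : ∀ e, a₃ ∈ ends e → e = f₁ ∨ e = f₂) (h3o : a₃ ≠ o) (h3b : a₃ ≠ b) (h31 : a₃ ≠ a₁)
    (h32 : a₃ ≠ a₂) (b₁ b₂ : Bool) :
    ∀ ω ∈ outc₂ f₁ f₂ b₁ b₂, ω ∈ PDEvent ends a₁ a₂ a₃ ↔
      closeStar ends a₃ ω ∈ tbl (avoidAll ends a₂ {a₁})
        (avoidAll ends a₂ {a₁} ∩ oN ends o a₁ a₂) (avoidAll ends a₂ {a₁} ∩ oN ends b a₁ a₂)
        (avoidAll ends a₂ {a₁} ∩ oN ends o a₁ a₂ ∩ oN ends b a₁ a₂) b₁ b₂ := by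
  rintro ω ⟨h1, h2⟩
  cases b₁ <;> cases b₂ <;>
    simp only [tbl, oN, ↓reduceIte, Bool.false_eq_true, StarO.mem_PD, avoidAll_eq_compl,
      Set.mem_inter_iff, Set.mem_compl_iff, mem_connEvent]
  · rw [conn_iff_single hf₁ hf₂ hstar h3o h3b (by simp [h1]) h31.symm h32.symm]
    have := not_conn_a3_cc hf₁ hf₂ hstar h3o h3b h1 h2 h31.symm
    have := not_conn_a3_cc hf₁ hf₂ hstar h3o h3b h1 h2 h32.symm
    tauto
  · rw [conn_iff_single hf₁ hf₂ hstar h3o h3b (by simp [h1]) h31.symm h32.symm,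
      conn_a3_iff_f2 hf₁ hf₂ hstar h3o h3b h1 h2 h31.symm,
      conn_a3_iff_f2 hf₁ hf₂ hstar h3o h3b h1 h2 h32.symm]
  · rw [conn_iff_single hf₁ hf₂ hstar h3o h3b (by simp [h2]) h31.symm h32.symm,
      conn_a3_iff_f1 hf₁ hf₂ hstar h3o h3b h1 h2 h31.symm,
      conn_a3_iff_f1 hf₁ hf₂ hstar h3o h3b h1 h2 h32.symm]
  · rw [conn_iff_glue_ob hf₁ hf₂ hstar h3o h3b h1 h2 h31.symm h32.symm,
      conn_a3_iff_oo hf₁ hf₂ hstar h3o h3b h1 h2 h31.symm,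
      conn_a3_iff_oo hf₁ hf₂ hstar h3o h3b h1 h2 h32.symm]
    have c1 : Conn ends (closeStar ends a₃ ω) a₁ o ↔ Conn ends (closeStar ends a₃ ω) o a₁ :=
      ⟨conn_symm, conn_symm⟩
    have c2 : Conn ends (closeStar ends a₃ ω) a₁ b ↔ Conn ends (closeStar ends a₃ ω) b a₁ :=
      ⟨conn_symm, conn_symm⟩
    have c3 : Conn ends (closeStar ends a₃ ω) b a₂ ↔ Conn ends (closeStar ends a₃ ω) a₂ b :=
      ⟨conn_symm, conn_symm⟩
    have c4 : Conn ends (closeStar ends a₃ ω) o a₂ ↔ Conn ends (closeStar ends a₃ ω) a₂ o :=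
      ⟨conn_symm, conn_symm⟩
    tauto

end Pointwise

end StarOB

end Summit.Ventures.PercRepro2
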